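import Summits.QuantumFields.BalabanUV.T4Continuum.Support.NE7DatumRefinement
import Summits.QuantumFields.BalabanUV.T4Continuum.Support.MinimalActionExistence
import HarnessLib

/-!
# NE7SymmetricAdmissibleWitness — A SYMMETRIC ADMISSIBLE CONFIGURATION OVER EVERY DATUM AT EVERY LEVEL, AND A SYMMETRIC RESTRICTED MINIMISER: the iterated
# SLAB refinement ([Balaban1985Variational] (11), the tree's `NE7DatumRefinement`) of a datum `D` is FIXED by the block-constant lift `x ↦ s(⌊x∕L^k⌋)` of every
# gauge transformation `s` fixing `D`; hence the `s`-symmetric admissible configurations of the small-field class form a NON-EMPTY COMPACT set and the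
# level action attains its minimum on it

Cell `pub-balaban`, rung (B)+1 sub-cell t4, lineage `b2b-balaban-t4-ne7b-p1` (row NE7b OWNER + CRUX PROVER; junction service for row NE7, ruling
R-OWNER-149-1 (2)), generation 158.  File 3 of the junction census of ROAD-G114 §8's STABILISER DESIGN ISSUE (files 1–2: `NE7InvariantFunctionalLetter`,
`NE7SymmetricCriticality`).
THE ARGUMENT.  The slab configuration `R` of `D` (`R(x,κ) = D(⌊x∕L⌋, κ)` if `x_κ ≡ L−1 (mod L)`, `= 1` otherwise) satisfies, for EVERY site field `s`,
`(R)^{ŝ} = slab of D^{s}` with `ŝ(x) = s(⌊x∕L⌋)`: on an in-block bond both ends of the bond lie in the same block and `ŝ(x)·1·ŝ(x+e_κ)⁻¹ = 1`; on a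
slab bond `⌊(x+e_κ)∕L⌋ = ⌊x∕L⌋ + e_κ` and the value is `D^{s}(⌊x∕L⌋, κ)`.  So `D^{s} = D ⟹ R^{ŝ} = R`; iterating through the levels
(`avgIter L U (k+1) = rescale L (bavg L (avgIter L U k))`, `⌊⌊x∕L^k⌋∕L⌋ = ⌊x∕L^{k+1}⌋`) gives at every level `k` a unitary `(N·L^k)`-periodic `U` with the
datum's plaquette radius, `avgIter L U k = D`, fixed by `x ↦ s(⌊x∕L^k⌋)` for every `s` fixing `D`.  With the datum radius `≤ ε∕(L^k)²` this `U` is admissible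
for `sfClass d L N ε` at level `k`; the symmetric admissible set is compact (`MinimalActionExistence.isCompact_admissible` ∩ a closed fixed-point set) and
non-empty, so `levelAction` attains its minimum there.
WHAT ([folklore]; 0 def, 0 sorry; every `d`, every `U(n)`).  §1 `ediv_add_one_of_emod_ne ∕ _eq`, `blockIdx_add_e_of_ne ∕ _eq`; §2 **`gaugeAct_lift_slab_eq`** (the
slab of a fixed datum is fixed by the lift); §3 **`exists_symmetric_admissible`**; §4 `continuous_gaugeAct'`, `isClosed_fixedSet`,
**`exists_symmetric_restricted_minimiser`**.
HONEST FRAMING (page 1): elementary lattice bookkeeping + compactness over the tree's objects; no estimate; nothing of Bałaban's asserted ((11) p. 279 is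
quoted for what it constructs); NOT NE7, NOT NE3, row NE7b NOT PRINTED ∕ NOT PROVED; spine 0∕9; finite T⁴ rung (B)+1 — NOT infinite volume, NOT mass gap,
NOT BetaPertH, NOT Clay (continuum YM on T⁴ ⇐ BetaPertH ∧ nine spine estimates).
-/

set_option autoImplicit false

open scoped BigOperators Matrix Matrix.Norms.L2Operator Topology
open Finset

namespace Summit.QuantumFields.BalabanUV.T4Continuum.NE7SymmetricAdmissibleWitness

open Literature.MathematicalPhysics.QuantumFieldTheory.Balaban1983to89
open B7Prop1Explicit B7Prop2Explicit
open T4AveragingDeficitWall (IsUnitaryCfg SmallField)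
open T4AveragingDeficitWallBoundary (IsPeriodicCfg)
open MinimalActionLevels (levelAction)
open MinimalActionSandwich (admissible)
open MinimalActionRate (sfClass)
open MinimalActionCompact (continuous_eval continuous_levelAction)
open MinimalActionExistence (isCompact_admissible)
open NE7DatumRefinement (isUnitaryCfg_slab isPeriodicCfg_slab smallField_slab rescale_bavg_slab)

noncomputable section

variable {d : ℕ} {n : Type*} [Fintype n] [DecidableEq n]

/-! ## §1 Integer bookkeeping: the block index of a shifted site -/

/-- `(t+1)∕L = t∕L` when `t mod L ≠ L−1`. [folklore] -/
theorem ediv_add_one_of_emod_ne {L : ℕ} (hL : 1 ≤ L) {t : ℤ} (h : t % (L : ℤ) ≠ L - 1) : (t + 1) / (L : ℤ) = t / (L : ℤ) := by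
  have hL0 : (L : ℤ) ≠ 0 := by exact_mod_cast (by omega : L ≠ 0)
  have hLpos : (0 : ℤ) < L := by exact_mod_cast (by omega : 0 < L)
  have h0 := Int.emod_nonneg t hL0
  have h1 := Int.emod_lt_of_pos t hLpos
  have hdecomp : t + 1 = (t % (L : ℤ) + 1) + (L : ℤ) * (t / (L : ℤ)) := by
    have := Int.emod_add_mul_ediv t (L : ℤ); linarith
  rw [hdecomp, Int.add_mul_ediv_left _ _ hL0, Int.ediv_eq_zero_of_lt (by linarith) (by omega), zero_add]

/-- `(t+1)∕L = t∕L + 1` when `t mod L = L−1`. [folklore] -/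
theorem ediv_add_one_of_emod_eq {L : ℕ} (hL : 1 ≤ L) {t : ℤ} (h : t % (L : ℤ) = L - 1) : (t + 1) / (L : ℤ) = t / (L : ℤ) + 1 := by
  have hL0 : (L : ℤ) ≠ 0 := by exact_mod_cast (by omega : L ≠ 0)
  have hdecomp : t + 1 = (L : ℤ) * (t / (L : ℤ) + 1) := by
    have := Int.emod_add_mul_ediv t (L : ℤ); rw [h] at this; linarith
  rw [hdecomp, Int.mul_ediv_cancel_left _ hL0]

/-- On an in-block bond the two endpoints have the same block index. [folklore] -/
theorem blockIdx_add_e_of_ne {L : ℕ} (hL : 1 ≤ L) {x : Site d} {κ : Fin d} (h : x κ % (L : ℤ) ≠ L - 1) :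
    (fun i => (x + e κ) i / (L : ℤ)) = fun i => x i / (L : ℤ) := by
  funext i
  simp only [Pi.add_apply, e_apply]
  by_cases hi : i = κ
  · subst hi; simp only [if_true]; exact ediv_add_one_of_emod_ne hL h
  · simp only [if_neg hi, add_zero]

/-- On a slab bond the far endpoint lies in the next block. [folklore] -/
theorem blockIdx_add_e_of_eq {L : ℕ} (hL : 1 ≤ L) {x : Site d} {κ : Fin d} (h : x κ % (L : ℤ) = L - 1) :
    (fun i => (x + e κ) i / (L : ℤ)) = (fun i => x i / (L : ℤ)) + e κ := by
  funext i
  simp only [Pi.add_apply, e_apply]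
  by_cases hi : i = κ
  · subst hi; simp only [if_true]; exact ediv_add_one_of_emod_eq hL h
  · simp only [if_neg hi, add_zero]

/-- `⌊⌊t∕L^k⌋∕L⌋ = ⌊t∕L^{k+1}⌋`. [folklore] -/
theorem ediv_pow_ediv (L : ℕ) (k : ℕ) (t : ℤ) : t / ((L : ℤ) ^ k) / (L : ℤ) = t / ((L : ℤ) ^ (k + 1)) := by
  rw [Int.ediv_ediv_of_nonneg (by positivity), pow_succ]

/-! ## §2 The slab of a fixed datum is fixed by the block-constant lift -/

/-- **THE SLAB IS EQUIVARIANT**: for every site field `s`, the gauge transform of the slab configuration `R` of `D` by the block-constant lift `ŝ(x) = s(⌊x∕L⌋)`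
is the slab configuration of `D^{s}` — read clause by clause. [folklore] -/
theorem gaugeAct_lift_slab {L : ℕ} (hL : 1 ≤ L) {D R : Site d → Fin d → (Matrix n n ℂ)ˣ}
    (hR1 : ∀ (x : Site d) (κ : Fin d), x κ % (L : ℤ) ≠ L - 1 → R x κ = 1)
    (hR0 : ∀ (x : Site d) (κ : Fin d), x κ % (L : ℤ) = L - 1 → R x κ = D (fun i => x i / (L : ℤ)) κ) (s : Site d → (Matrix n n ℂ)ˣ) :
    (∀ (x : Site d) (κ : Fin d), x κ % (L : ℤ) ≠ L - 1 → gaugeAct (fun y => s (fun i => y i / (L : ℤ))) R x κ = 1) ∧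
    (∀ (x : Site d) (κ : Fin d), x κ % (L : ℤ) = L - 1 →
      gaugeAct (fun y => s (fun i => y i / (L : ℤ))) R x κ = gaugeAct s D (fun i => x i / (L : ℤ)) κ) := by
  refine ⟨fun x κ h => ?_, fun x κ h => ?_⟩
  · show s (fun i => x i / (L : ℤ)) * R x κ * (s (fun i => (x + e κ) i / (L : ℤ)))⁻¹ = 1
    rw [hR1 x κ h, mul_one, blockIdx_add_e_of_ne hL h, mul_inv_cancel]
  · show s (fun i => x i / (L : ℤ)) * R x κ * (s (fun i => (x + e κ) i / (L : ℤ)))⁻¹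
        = s (fun i => x i / (L : ℤ)) * D (fun i => x i / (L : ℤ)) κ * (s ((fun i => x i / (L : ℤ)) + e κ))⁻¹
    rw [hR0 x κ h, blockIdx_add_e_of_eq hL h]

/-- **THE SLAB OF A FIXED DATUM IS FIXED BY THE LIFT**: `D^{s} = D ⟹ R^{ŝ} = R`. [folklore] -/
theorem gaugeAct_lift_slab_eq {L : ℕ} (hL : 1 ≤ L) {D R : Site d → Fin d → (Matrix n n ℂ)ˣ}
    (hR1 : ∀ (x : Site d) (κ : Fin d), x κ % (L : ℤ) ≠ L - 1 → R x κ = 1)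
    (hR0 : ∀ (x : Site d) (κ : Fin d), x κ % (L : ℤ) = L - 1 → R x κ = D (fun i => x i / (L : ℤ)) κ) {s : Site d → (Matrix n n ℂ)ˣ}
    (hs : gaugeAct s D = D) : gaugeAct (fun y => s (fun i => y i / (L : ℤ))) R = R := by
  obtain ⟨h1, h0⟩ := gaugeAct_lift_slab hL hR1 hR0 s
  funext x κ
  by_cases h : x κ % (L : ℤ) = L - 1
  · rw [h0 x κ h, hs, hR0 x κ h]
  · rw [h1 x κ h, hR1 x κ h]

/-! ## §3 The symmetric admissible witness at every level -/

/-- **A SYMMETRIC ADMISSIBLE CONFIGURATION OVER EVERY DATUM AT EVERY LEVEL**: for `L ≥ 1`, every level `k`, every unitary `N`-periodic datum `D` with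
`SmallField D a` (`a ≥ 0`) there is a unitary `(N·L^k)`-periodic `U` with `SmallField U a`, `avgIter L U k = D`, FIXED by the block-constant lift
`x ↦ s(⌊x∕L^k⌋)` of EVERY site field `s` with `D^{s} = D` (the `k`-fold iterated slab refinement of [Balaban1985Variational] (11)). [folklore] -/
theorem exists_symmetric_admissible {L : ℕ} [NeZero L] (hL : 1 ≤ L) (k : ℕ) :
    ∀ {N : ℕ} {D : Site d → Fin d → (Matrix n n ℂ)ˣ}, IsUnitaryCfg D → IsPeriodicCfg D (N : ℤ) → ∀ {a : ℝ}, 0 ≤ a → SmallField D a →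
    ∃ U : Site d → Fin d → (Matrix n n ℂ)ˣ, IsUnitaryCfg U ∧ IsPeriodicCfg U ((N * L ^ k : ℕ) : ℤ) ∧ SmallField U a ∧ avgIter L U k = D ∧
      ∀ s : Site d → (Matrix n n ℂ)ˣ, gaugeAct s D = D → gaugeAct (fun x => s (fun i => x i / ((L : ℤ) ^ k))) U = U := by
  classical
  induction k with
  | zero =>
      intro N D hDu hDP a ha hDa
      refine ⟨D, hDu, by simpa using hDP, hDa, rfl, fun s hs => ?_⟩
      have h1 : (fun x : Site d => s (fun i => x i / ((L : ℤ) ^ 0))) = s := by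
        funext x; simp only [pow_zero, Int.ediv_one]
      rw [h1, hs]
  | succ k ih =>
      intro N D hDu hDP a ha hDa
      -- the slab refinement of `D`
      let R : Site d → Fin d → (Matrix n n ℂ)ˣ := fun x κ => if x κ % (L : ℤ) = L - 1 then D (fun i => x i / (L : ℤ)) κ else 1
      have hR1 : ∀ (x : Site d) (κ : Fin d), x κ % (L : ℤ) ≠ L - 1 → R x κ = 1 := fun x κ h => if_neg h
      have hR0 : ∀ (x : Site d) (κ : Fin d), x κ % (L : ℤ) = L - 1 → R x κ = D (fun i => x i / (L : ℤ)) κ := fun x κ h => if_pos h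
      obtain ⟨U, hUu, hUP, hUa, havg, hsym⟩ :=
        ih (isUnitaryCfg_slab hR1 hR0 hDu) (isPeriodicCfg_slab hL hR1 hR0 hDP) ha (smallField_slab hL hR1 hR0 ha hDa)
      refine ⟨U, hUu, ?_, hUa, ?_, fun s hs => ?_⟩
      · have hc : ((N * L * L ^ k : ℕ) : ℤ) = ((N * L ^ (k + 1) : ℕ) : ℤ) := by push_cast; ring
        rw [← hc]; exact hUP
      · rw [avgIter_succ, havg]; exact rescale_bavg_slab hL hR1 hR0
      · have h := hsym (fun y => s (fun i => y i / (L : ℤ))) (gaugeAct_lift_slab_eq hL hR1 hR0 hs)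
        have hfun : (fun x : Site d => (fun y : Site d => s (fun i => y i / (L : ℤ))) (fun i => x i / ((L : ℤ) ^ k)))
            = fun x => s (fun i => x i / ((L : ℤ) ^ (k + 1))) := by
          funext x
          simp only [ediv_pow_ediv]
        rw [hfun] at h
        exact h

/-! ## §4 The symmetric restricted minimiser -/

/-- The gauge action `U ↦ U^{w}` is continuous in the product topology. [folklore] -/
theorem continuous_gaugeAct' (w : Site d → (Matrix n n ℂ)ˣ) : Continuous fun U : Site d → Fin d → (Matrix n n ℂ)ˣ => gaugeAct w U := by
  refine continuous_pi fun x => continuous_pi fun μ => ?_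
  show Continuous fun U : Site d → Fin d → (Matrix n n ℂ)ˣ => w x * U x μ * (w (x + e μ))⁻¹
  exact (continuous_const.mul (continuous_eval (n := n) x μ)).mul continuous_const

/-- The set of configurations fixed by a family of gauge transformations is closed. [folklore] -/
theorem isClosed_fixedSet (𝒲 : Set (Site d → (Matrix n n ℂ)ˣ)) :
    IsClosed {U : Site d → Fin d → (Matrix n n ℂ)ˣ | ∀ w ∈ 𝒲, gaugeAct w U = U} := by
  have h : {U : Site d → Fin d → (Matrix n n ℂ)ˣ | ∀ w ∈ 𝒲, gaugeAct w U = U} = ⋂ w ∈ 𝒲, {U | gaugeAct w U = U} := by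
    ext U; simp only [Set.mem_setOf_eq, Set.mem_iInter]
  rw [h]
  exact isClosed_biInter fun w _ => isClosed_eq (continuous_gaugeAct' w) continuous_id

/-- **THE SYMMETRIC RESTRICTED MINIMISER**: for `L ≥ 2`, `ε` in the compactness regime of `MinimalActionExistence`, a unitary `N`-periodic datum `V₀` with
`SmallField V₀ δ`, `0 ≤ δ ≤ ε∕(L^k)²`, and ANY set `K` of site fields fixing `V₀`: among the admissible configurations of `sfClass d L N ε` at level `k` over
`V₀` that are FIXED by the block-constant lifts `x ↦ s(⌊x∕L^k⌋)`, `s ∈ K`, there is one of least level action. [folklore] -/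
theorem exists_symmetric_restricted_minimiser [Nonempty n] {L : ℕ} (hL : 2 ≤ L) {ε : ℝ} (hε0 : 0 ≤ ε)
    (hε1 : 16 * C0 d * ε ≤ 3) (hε2 : 1024 * (d + 1) * (d + 4) * (L : ℝ) ^ 2 * ε ≤ 1) {N : ℕ} (k : ℕ)
    {V₀ : Site d → Fin d → (Matrix n n ℂ)ˣ} (hV₀u : IsUnitaryCfg V₀) (hV₀P : IsPeriodicCfg V₀ (N : ℤ)) {δ : ℝ} (hδ0 : 0 ≤ δ)
    (hV₀δ : SmallField V₀ δ) (hδε : δ ≤ ε / ((L : ℝ) ^ k) ^ 2) (K : Set (Site d → (Matrix n n ℂ)ˣ)) (hK : ∀ s ∈ K, gaugeAct s V₀ = V₀) :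
    ∃ U : Site d → Fin d → (Matrix n n ℂ)ˣ, U ∈ admissible (sfClass d L N ε) L k V₀ ∧
      (∀ s ∈ K, gaugeAct (fun x => s (fun i => x i / ((L : ℤ) ^ k))) U = U) ∧
      ∀ U' ∈ admissible (sfClass d L N ε) L k V₀, (∀ s ∈ K, gaugeAct (fun x => s (fun i => x i / ((L : ℤ) ^ k))) U' = U') →
        levelAction d L N k U ≤ levelAction d L N k U' := by
  haveI : NeZero L := ⟨by omega⟩
  have hL1 : 1 ≤ L := by omega
  -- the symmetric admissible set is compact and non-empty
  set A : Set (Site d → Fin d → (Matrix n n ℂ)ˣ) := admissible (sfClass d L N ε) L k V₀ ∩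
    {U | ∀ w ∈ (fun s : Site d → (Matrix n n ℂ)ˣ => fun x : Site d => s (fun i => x i / ((L : ℤ) ^ k))) '' K, gaugeAct w U = U} with hA
  have hAc : IsCompact A := (isCompact_admissible hL hε0 hε1 hε2 N k V₀).inter_right (isClosed_fixedSet _)
  obtain ⟨U₁, hU₁u, hU₁P, hU₁δ, havg, hsym⟩ := exists_symmetric_admissible (n := n) hL1 k hV₀u hV₀P hδ0 hV₀δ
  have hU₁A : U₁ ∈ A := by
    refine ⟨⟨⟨hU₁u, hU₁P, MinimalActionRate.SmallField.mono hU₁δ hδε⟩, havg⟩, ?_⟩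
    rintro _ ⟨s, hs, rfl⟩
    exact hsym s (hK s hs)
  obtain ⟨U, hU, hmin⟩ := hAc.exists_isMinOn ⟨U₁, hU₁A⟩ (continuous_levelAction (d := d) (n := n) L N k).continuousOn
  refine ⟨U, hU.1, fun s hs => hU.2 _ ⟨s, hs, rfl⟩, fun U' hU' hU's => hmin ⟨hU', ?_⟩⟩
  rintro _ ⟨s, hs, rfl⟩
  exact hU's s hs

end

end Summit.QuantumFields.BalabanUV.T4Continuum.NE7SymmetricAdmissibleWitness
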